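import Summits.QuantumFields.YangMills.Theorems.BalabanUVNodesN15NeumannCubeGradientDefect
import Summits.QuantumFields.YangMills.Theorems.BalabanUVNodesN15NeumannCubeOutputRows
import HarnessLib

/-!
# Route «BalabanUVNodes» (K3⁷), node N15 = NE2, -a lane, PROGRAMME N file N-IIh: THE η-DEFECT OF THE ADJOINT-DIFFERENCE OUTPUT ROW `χ_□ ∘ ∇*_μ ∘ G(□ + c)` OF THE NEUMANN CUBES
# — exact split identity and the HYPOTHESIS-FREE letter (rate `(L^k)^{−1∕16}`); the defect of dag-n15-c's `hDbc` rows

Cell `pub-ymgap`, seat `pub-ymgap-dag-n15-a` (KNIT-BY-NAME, g19; D-0062; chair R424 venue; `bears_on: R4∕N15`); `--kind proof --supports stmt-QuantumFields-20544 --as helper`.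
Sequel of N-IIe `…N15NeumannCubeGradientDefect` (forward entry 1) and N-IIf `…N15NeumannCubeOutputRows` (the row itself).  Inputs BY NAME: part 53 `hasMaj_twoGridDefect_grad`, dag-n15-c W1
`GenuineSite.hasMaj_twoGridDefect_grad_backward`, part 44 `hasMaj_gradStep_of_ineq`, `ineq110_114_pair`, W1 `hasMaj_bshiftV_comp`; N-IId `symbOp_divAdj_comp_reflSet_of_(not_)mem`, N-IIf
`symbOp_divAdj_eq_neg_bshiftV`∕`mulOp_comp_divAdj_comp_symOp_comp`; N-IIa∕b∕c∕e bookkeeping.  CONSUMER: dag-n15-c's `hDK` rows for the backward∕adjoint `D⁻∘G_□` pieces (FILE 63's `hDbc`).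

WHAT.  §23 ★★ `idef_reflSet_sandwich` (EXACT, any `Y′, Y`: `𝔇(χ′∘R′_T∘Y′∘M_{χ′}, χ∘R_T∘Y∘M_χ) = χ′∘R′_T∘𝔇(Y′,Y)∘M_χ + M_{mask_T}∘P∘(χ∘R_T∘(D∘Y∘M_χ))`),
★★★ `idef_chiCube_divAdjOut_neumannCubeG_split` (EXACT: over the `2^d` subsets `T ∌ μ`, the pair `(T, T∪{μ})` contributes MINUS the images-dressed torus defect of `S_{−μ}∇_μG` with its
face term, PLUS that of `∇_μG` with its face term — `∇*_μ∘R_T = R_T∘∇*_μ`, `∇*_μ = −S_{−μ}∇_μ`, `∇*_μ∘R_{T∪{μ}} = R_{T∪{μ}}∘∇_μ`), ★★★ `hasMaj_idef_chiCube_divAdjOut_neumannCubeG_of` (any torus: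
`≤ 1_□1_□·2^d e^δ(C₀ + C₀′ + (d+1)(C₃ + C₃′)∕L^k)·e^{−δd}`), ★★★ `hasMaj_idef_chiCube_divAdjOut_neumannCubeG`: for odd `L ≥ 3`, `a > 0`: `∃ δ m > 0, ∀ m_T k r (k ≥ 1, L^k ≥ 4) (hL) c ν`,
`𝔇(χ′_□∇′*_νG′(□), χ_□∇*_νG(□)) ≤ 1_□(y)1_□(y′)·m·(L^k)^{−1∕16}·e^{−δ|y−y′|_T}`.
HONEST FRAMING.  Lattice algebra + block-majorant bookkeeping over LANDED torus letters; no new analytic estimate; `U ≡ 1` torus MODEL on the doubled-cube family (one-cube model — ref-B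
OBSERVATION-2∕CAUTION-P (4)); nothing of [B6]∕[B9] asserted; N15 NOT discharged (object-bound; NE2⁺ NOT PRINTED); counts UNMOVED (typed 28∕28 · discharged 5∕27); one finite torus pair
per index — NOT continuum ∕ ℝ⁴ ∕ OS ∕ mass gap ∕ Clay.  Theorems only (0 `def`).
-/

noncomputable section

open scoped BigOperators Matrix
open Finset

namespace Summit.QuantumFields.YangMills.BalabanUVNodes.N15.TwoGrid

open Literature.MathematicalPhysics.QuantumFieldTheory.Balaban1983to89
open Literature.MathematicalPhysics.QuantumFieldTheory.Balaban1983to89.B5Prop11Plancherel (Tor fine unitVec)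
open Literature.MathematicalPhysics.QuantumFieldTheory.Balaban1983to89.B5Block118 (up bpt)
open Literature.MathematicalPhysics.QuantumFieldTheory.Balaban1983to89.B6Prop26Gluing (mulOp mulOp_apply ind ind_nonneg ind_le_one)
open Literature.MathematicalPhysics.QuantumFieldTheory.King1986.Torus (blockOf tdistT)
open Literature.MathematicalPhysics.QuantumFieldTheory.Balaban1983to89.B11SectG (BlockNorm HasMaj)
open Literature.MathematicalPhysics.QuantumFieldTheory.Balaban1983to89.B6UnitTorusCarrier (unitTorusGeo)
open Literature.MathematicalPhysics.QuantumFieldTheory.Balaban1983to89.B5SiteBridgeP12 (MP)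
open Literature.MathematicalPhysics.QuantumFieldTheory.Balaban1983to89.B5SettingP12Real (latticeSettingP12R)
open Literature.MathematicalPhysics.QuantumFieldTheory.Balaban1983to89.T4EtaRateDefect (idef idef_comp idef_apply)
open Literature.MathematicalPhysics.QuantumFieldTheory.Balaban1983to89.T4EtaRateCoeffDefect (pull pull_apply)
open Summit.QuantumFields.YangMills.BalabanUVNodes.N15.VectorPiece (blkFine kingPr kingPrV blkFine_comp_kingPrV bshiftV bshiftV_apply hasMaj_bshiftV_comp)

variable {d : ℕ}

/-! ## §23 THE η-DEFECT OF THE ADJOINT-DIFFERENCE OUTPUT ROW `χ_□ ∘ ∇*_μ ∘ G(□ + c)` (dag-n15-c's (α) row, both members): exact split identity and the letter -/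

section DivAdjOutDefect

variable {M : Fin (d + 1) → ℕ} [∀ μ, NeZero (M μ)] (L k r : ℕ) [NeZero L] (c : Tor M) (S : ℕ)

/-- ★★ **ONE REFLECTED SANDWICH THROUGH THE PROLONGATION, EXACTLY**: for any torus operators `Y′, Y`,
`𝔇(χ′∘R′_T∘Y′∘M_{χ′}, χ∘R_T∘Y∘M_χ) = χ′∘R′_T∘𝔇(Y′, Y)∘M_χ + M_{mask_T}∘P∘(χ∘R_T∘(D∘Y∘M_χ))`. [cite: Balaban1985BackgroundPropagators, Thm 3.14 pp.426–427 (difference template)] -/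
theorem idef_reflSet_sandwich (T : Finset (Fin (d + 1)))
    (Y' : (Tor (fine (L ^ r * L ^ k) M) × Fin (d + 1) → ℝ) →ₗ[ℝ] (Tor (fine (L ^ r * L ^ k) M) × Fin (d + 1) → ℝ))
    (Y : (Tor (fine (L ^ k) M) × Fin (d + 1) → ℝ) →ₗ[ℝ] (Tor (fine (L ^ k) M) × Fin (d + 1) → ℝ)) :
    idef (pull (kingPrV L k r M)) (pull (kingPrV L k r M)) (mulOp (chiCube M (L ^ r * L ^ k) c S) ∘ₗ reflSet M (L ^ r * L ^ k) c T ∘ₗ (Y' ∘ₗ mulOp (chiCube M (L ^ r * L ^ k) c S))) (mulOp (chiCube M (L ^ k) c S) ∘ₗ reflSet M (L ^ k) c T ∘ₗ (Y ∘ₗ mulOp (chiCube M (L ^ k) c S))) =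
      mulOp (chiCube M (L ^ r * L ^ k) c S) ∘ₗ reflSet M (L ^ r * L ^ k) c T ∘ₗ idef (pull (kingPrV L k r M)) (pull (kingPrV L k r M)) Y' Y ∘ₗ mulOp (chiCube M (L ^ k) c S) + mulOp (faceMask M (L ^ r * L ^ k) (L ^ r) T) ∘ₗ pull (kingPrV L k r M) ∘ₗ (mulOp (chiCube M (L ^ k) c S) ∘ₗ reflSet M (L ^ k) c T ∘ₗ (ownDiff M (L ^ k) ∘ₗ Y ∘ₗ mulOp (chiCube M (L ^ k) c S))) := by
  refine LinearMap.ext fun f => ?_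
  have hχ : ∀ u : Tor (fine (L ^ k) M) × Fin (d + 1) → ℝ, pull (kingPrV L k r M) (mulOp (chiCube M (L ^ k) c S) u) = mulOp (chiCube M (L ^ r * L ^ k) c S) (pull (kingPrV L k r M) u) := fun u => by
    have := LinearMap.congr_fun (pull_kingPrV_comp_mulOp_chiCube L k r c S) u
    simpa only [LinearMap.comp_apply] using this
  have hR : ∀ Z : Tor (fine (L ^ k) M) × Fin (d + 1) → ℝ, pull (kingPrV L k r M) (reflSet M (L ^ k) c T Z) = reflSet M (L ^ r * L ^ k) c T (pull (kingPrV L k r M) Z) - mulOp (faceMask M (L ^ r * L ^ k) (L ^ r) T) (pull (kingPrV L k r M) (reflSet M (L ^ k) c T (ownDiff M (L ^ k) Z))) := fun Z => by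
    rw [reflSet_pull_kingPrV, add_sub_cancel_right]
  simp only [idef_apply, LinearMap.comp_apply, LinearMap.add_apply]
  rw [← hχ f, hχ (reflSet M (L ^ k) c T _), hR]
  funext b'
  simp only [map_sub, Pi.sub_apply, Pi.add_apply, mulOp_apply, pull_apply, chiCube_kingPrV]
  ring

variable (a : ℝ)

/-- ★★★ **THE η-DEFECT OF THE ADJOINT-DIFFERENCE OUTPUT ROW, EXACTLY, IMAGES PAIRED BY THE DIRECTION** `μ`: with `H_□ = χ_□∘∇*_μ∘G(□ + c)` and its fine twin, over the `2^d` subsets `T ∌ μ`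
the pair `(T, T ∪ {μ})` contributes MINUS the images-dressed torus defect of `S_{−μ}∇_μG` with its face term (`∇*_μ∘R_T = R_T∘∇*_μ`, `∇*_μ = −S_{−μ}∇_μ`), PLUS the images-dressed torus
defect of `∇_μG` with its face term (`∇*_μ∘R_{T∪{μ}} = R_{T∪{μ}}∘∇_μ`). [cite: Balaban1985BackgroundPropagators, Thm 3.14 pp.426–427, (3.42) p.397 (shape); Balaban1984PropagatorsII, (2.37) p.229] -/
theorem idef_chiCube_divAdjOut_neumannCubeG_split (hM : ∀ ν, M ν = 2 * S) (ha : 0 < a) (μ : Fin (d + 1)) :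
    idef (pull (kingPrV L k r M)) (pull (kingPrV L k r M)) (mulOp (chiCube M (L ^ r * L ^ k) c S) ∘ₗ symbOp M (L ^ r * L ^ k) (((L ^ r * L ^ k : ℕ) : ℝ) • (sTinv M (L ^ r * L ^ k) μ - 1)) ∘ₗ neumannCubeG M (L ^ r * L ^ k) c S a) (mulOp (chiCube M (L ^ k) c S) ∘ₗ symbOp M (L ^ k) (((L ^ k : ℕ) : ℝ) • (sTinv M (L ^ k) μ - 1)) ∘ₗ neumannCubeG M (L ^ k) c S a) =
      ∑ T ∈ ((Finset.univ : Finset (Fin (d + 1))).erase μ).powerset,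
        (-(mulOp (chiCube M (L ^ r * L ^ k) c S) ∘ₗ reflSet M (L ^ r * L ^ k) c T ∘ₗ idef (pull (kingPrV L k r M)) (pull (kingPrV L k r M)) (bshiftV M (L ^ r * L ^ k) μ ∘ₗ (symbOp M (L ^ r * L ^ k) (sD M (L ^ r * L ^ k) μ ((L ^ r * L ^ k : ℕ) : ℝ)) ∘ₗ gOp M (L ^ r * L ^ k) a)) (bshiftV M (L ^ k) μ ∘ₗ (symbOp M (L ^ k) (sD M (L ^ k) μ ((L ^ k : ℕ) : ℝ)) ∘ₗ gOp M (L ^ k) a)) ∘ₗ mulOp (chiCube M (L ^ k) c S) + mulOp (faceMask M (L ^ r * L ^ k) (L ^ r) T) ∘ₗ pull (kingPrV L k r M) ∘ₗ (mulOp (chiCube M (L ^ k) c S) ∘ₗ reflSet M (L ^ k) c T ∘ₗ (ownDiff M (L ^ k) ∘ₗ (bshiftV M (L ^ k) μ ∘ₗ (symbOp M (L ^ k) (sD M (L ^ k) μ ((L ^ k : ℕ) : ℝ)) ∘ₗ gOp M (L ^ k) a)) ∘ₗ mulOp (chiCube M (L ^ k) c S)))) +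
          (mulOp (chiCube M (L ^ r * L ^ k) c S) ∘ₗ reflSet M (L ^ r * L ^ k) c (insert μ T) ∘ₗ idef (pull (kingPrV L k r M)) (pull (kingPrV L k r M)) (symbOp M (L ^ r * L ^ k) (sD M (L ^ r * L ^ k) μ ((L ^ r * L ^ k : ℕ) : ℝ)) ∘ₗ gOp M (L ^ r * L ^ k) a) (symbOp M (L ^ k) (sD M (L ^ k) μ ((L ^ k : ℕ) : ℝ)) ∘ₗ gOp M (L ^ k) a) ∘ₗ mulOp (chiCube M (L ^ k) c S) + mulOp (faceMask M (L ^ r * L ^ k) (L ^ r) (insert μ T)) ∘ₗ pull (kingPrV L k r M) ∘ₗ (mulOp (chiCube M (L ^ k) c S) ∘ₗ reflSet M (L ^ k) c (insert μ T) ∘ₗ (ownDiff M (L ^ k) ∘ₗ (symbOp M (L ^ k) (sD M (L ^ k) μ ((L ^ k : ℕ) : ℝ)) ∘ₗ gOp M (L ^ k) a) ∘ₗ mulOp (chiCube M (L ^ k) c S))))) := by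
  have hL0 : 0 < L := Nat.pos_of_ne_zero (NeZero.ne L)
  have hn : 1 ≤ L ^ k := Nat.one_le_pow _ _ hL0
  have hn' : 1 ≤ L ^ r * L ^ k := Nat.one_le_iff_ne_zero.mpr (Nat.mul_ne_zero (pow_ne_zero r (NeZero.ne L)) (by positivity))
  -- per image: the adjoint difference passes the reflection
  have eV : ∀ T : Finset (Fin (d + 1)), μ ∈ T →
      mulOp (chiCube M (L ^ k) c S) ∘ₗ symbOp M (L ^ k) (((L ^ k : ℕ) : ℝ) • (sTinv M (L ^ k) μ - 1)) ∘ₗ reflSet M (L ^ k) c T ∘ₗ gOp M (L ^ k) a ∘ₗ mulOp (chiCube M (L ^ k) c S) = mulOp (chiCube M (L ^ k) c S) ∘ₗ reflSet M (L ^ k) c T ∘ₗ ((symbOp M (L ^ k) (sD M (L ^ k) μ ((L ^ k : ℕ) : ℝ)) ∘ₗ gOp M (L ^ k) a) ∘ₗ mulOp (chiCube M (L ^ k) c S)) := by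
    intro T hμT
    refine LinearMap.ext fun f => ?_
    have h1 := LinearMap.congr_fun (symbOp_divAdj_comp_reflSet_of_mem (c := c) hμT ((L ^ k : ℕ) : ℝ)) (gOp M (L ^ k) a (mulOp (chiCube M (L ^ k) c S) f))
    simp only [LinearMap.comp_apply] at h1 ⊢
    rw [h1]
  have eV' : ∀ T : Finset (Fin (d + 1)), μ ∈ T →
      mulOp (chiCube M (L ^ r * L ^ k) c S) ∘ₗ symbOp M (L ^ r * L ^ k) (((L ^ r * L ^ k : ℕ) : ℝ) • (sTinv M (L ^ r * L ^ k) μ - 1)) ∘ₗ reflSet M (L ^ r * L ^ k) c T ∘ₗ gOp M (L ^ r * L ^ k) a ∘ₗ mulOp (chiCube M (L ^ r * L ^ k) c S) = mulOp (chiCube M (L ^ r * L ^ k) c S) ∘ₗ reflSet M (L ^ r * L ^ k) c T ∘ₗ ((symbOp M (L ^ r * L ^ k) (sD M (L ^ r * L ^ k) μ ((L ^ r * L ^ k : ℕ) : ℝ)) ∘ₗ gOp M (L ^ r * L ^ k) a) ∘ₗ mulOp (chiCube M (L ^ r * L ^ k) c S)) := by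
    intro T hμT
    refine LinearMap.ext fun f => ?_
    have h1 := LinearMap.congr_fun (symbOp_divAdj_comp_reflSet_of_mem (c := c) hμT ((L ^ r * L ^ k : ℕ) : ℝ)) (gOp M (L ^ r * L ^ k) a (mulOp (chiCube M (L ^ r * L ^ k) c S) f))
    simp only [LinearMap.comp_apply] at h1 ⊢
    rw [h1]
  have eW : ∀ T : Finset (Fin (d + 1)), μ ∉ T →
      mulOp (chiCube M (L ^ k) c S) ∘ₗ symbOp M (L ^ k) (((L ^ k : ℕ) : ℝ) • (sTinv M (L ^ k) μ - 1)) ∘ₗ reflSet M (L ^ k) c T ∘ₗ gOp M (L ^ k) a ∘ₗ mulOp (chiCube M (L ^ k) c S) = -(mulOp (chiCube M (L ^ k) c S) ∘ₗ reflSet M (L ^ k) c T ∘ₗ ((bshiftV M (L ^ k) μ ∘ₗ (symbOp M (L ^ k) (sD M (L ^ k) μ ((L ^ k : ℕ) : ℝ)) ∘ₗ gOp M (L ^ k) a)) ∘ₗ mulOp (chiCube M (L ^ k) c S))) := by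
    intro T hμT
    refine LinearMap.ext fun f => ?_
    have h1 := LinearMap.congr_fun (symbOp_divAdj_comp_reflSet_of_not_mem (c := c) hμT ((L ^ k : ℕ) : ℝ)) (gOp M (L ^ k) a (mulOp (chiCube M (L ^ k) c S) f))
    have h2 := LinearMap.congr_fun (symbOp_divAdj_eq_neg_bshiftV (M := M) (n := L ^ k) μ ((L ^ k : ℕ) : ℝ)) (gOp M (L ^ k) a (mulOp (chiCube M (L ^ k) c S) f))
    simp only [LinearMap.comp_apply, LinearMap.neg_apply] at h1 h2 ⊢
    rw [h1, h2, map_neg, map_neg]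
  have eW' : ∀ T : Finset (Fin (d + 1)), μ ∉ T →
      mulOp (chiCube M (L ^ r * L ^ k) c S) ∘ₗ symbOp M (L ^ r * L ^ k) (((L ^ r * L ^ k : ℕ) : ℝ) • (sTinv M (L ^ r * L ^ k) μ - 1)) ∘ₗ reflSet M (L ^ r * L ^ k) c T ∘ₗ gOp M (L ^ r * L ^ k) a ∘ₗ mulOp (chiCube M (L ^ r * L ^ k) c S) = -(mulOp (chiCube M (L ^ r * L ^ k) c S) ∘ₗ reflSet M (L ^ r * L ^ k) c T ∘ₗ ((bshiftV M (L ^ r * L ^ k) μ ∘ₗ (symbOp M (L ^ r * L ^ k) (sD M (L ^ r * L ^ k) μ ((L ^ r * L ^ k : ℕ) : ℝ)) ∘ₗ gOp M (L ^ r * L ^ k) a)) ∘ₗ mulOp (chiCube M (L ^ r * L ^ k) c S))) := by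
    intro T hμT
    refine LinearMap.ext fun f => ?_
    have h1 := LinearMap.congr_fun (symbOp_divAdj_comp_reflSet_of_not_mem (c := c) hμT ((L ^ r * L ^ k : ℕ) : ℝ)) (gOp M (L ^ r * L ^ k) a (mulOp (chiCube M (L ^ r * L ^ k) c S) f))
    have h2 := LinearMap.congr_fun (symbOp_divAdj_eq_neg_bshiftV (M := M) (n := L ^ r * L ^ k) μ ((L ^ r * L ^ k : ℕ) : ℝ)) (gOp M (L ^ r * L ^ k) a (mulOp (chiCube M (L ^ r * L ^ k) c S) f))
    simp only [LinearMap.comp_apply, LinearMap.neg_apply] at h1 h2 ⊢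
    rw [h1, h2, map_neg, map_neg]
  rw [neumannCubeG_eq_chiCube M (L ^ r * L ^ k) c S a hM hn' ha, neumannCubeG_eq_chiCube M (L ^ k) c S a hM hn ha, mulOp_comp_divAdj_comp_symOp_comp,
    mulOp_comp_divAdj_comp_symOp_comp, idef_finset_sum]
  conv_lhs => rw [← Finset.insert_erase (Finset.mem_univ μ)]
  rw [Finset.sum_powerset_insert (Finset.notMem_erase μ _), ← Finset.sum_add_distrib]
  refine Finset.sum_congr rfl fun T hT => ?_
  have hμT : μ ∉ T := fun h => Finset.notMem_erase μ _ (Finset.mem_powerset.mp hT h)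
  have hμT' : μ ∈ insert μ T := Finset.mem_insert_self μ T
  rw [eW T hμT, eW' T hμT, eV (insert μ T) hμT', eV' (insert μ T) hμT', idef_neg_neg, idef_reflSet_sandwich, idef_reflSet_sandwich]

end DivAdjOutDefect

section DivAdjOutLetter

open Literature.MathematicalPhysics.QuantumFieldTheory.Balaban1983to89.B5CoverP12Lattice (Lθ Lθ_nonneg)

variable {L : ℕ} [NeZero L] {M : Fin (d + 1) → ℕ} [∀ μ, NeZero (M μ)] {k r : ℕ} {c : Tor M} {S : ℕ}

/-- ★★★ **THE η-DEFECT OF THE ADJOINT-DIFFERENCE OUTPUT ROW FROM TORUS LETTERS** (any torus `M_ν = 2S`, `n = L^k`, `n′ = L^r·n`): the torus defects of `∇_νG` (`C₀`) and of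
`S_{−ν}∇_νG` (`C₀′`) and the second differences `∇_μ∇_νG` (`C₃`), `S_{−ν}∇_μ∇_νG` (`C₃′`) give `𝔇(H′_□, H_□) ≤ 1_□1_□·2^{d}e^{δ}(C₀ + C₀′ + (d+1)(C₃ + C₃′)∕L^k)·e^{−δd}`,
`H_□ = χ_□∘∇*_ν∘G(□ + c)`. [cite: Balaban1985BackgroundPropagators, Thm 3.14 pp.426–427, (3.42) p.397 (shape); Balaban1984PropagatorsII, (2.134) p.247, (2.37) p.229] -/
theorem hasMaj_idef_chiCube_divAdjOut_neumannCubeG_of (hM : ∀ ν, M ν = 2 * S) {a : ℝ} (ha : 0 < a) (ν : Fin (d + 1)) {C₀ C₀' C₃ C₃' δ : ℝ} (hC₀ : 0 ≤ C₀) (hC₀' : 0 ≤ C₀')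
    (hC₃ : 0 ≤ C₃) (hC₃' : 0 ≤ C₃') (hδ : 0 ≤ δ)
    (h0a : HasMaj (BlockNorm.ofBlocks (unitTorusGeo L k M) (fun b : Tor (fine (L ^ k) M) × Fin (d + 1) => blockOf (L ^ k) M b.1))
      (BlockNorm.ofBlocks (unitTorusGeo L k M) (fun b' : Tor (fine (L ^ r * L ^ k) M) × Fin (d + 1) => blockOf (L ^ r * L ^ k) M b'.1))
      (idef (pull (kingPrV L k r M)) (pull (kingPrV L k r M))
        (symbOp M (L ^ r * L ^ k) (sD M (L ^ r * L ^ k) ν ((L ^ r * L ^ k : ℕ) : ℝ)) ∘ₗ gOp M (L ^ r * L ^ k) a)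
        (symbOp M (L ^ k) (sD M (L ^ k) ν ((L ^ k : ℕ) : ℝ)) ∘ₗ gOp M (L ^ k) a))
      (fun y y' => C₀ * Real.exp (-(δ * tdistT M y y'))))
    (h0b : HasMaj (BlockNorm.ofBlocks (unitTorusGeo L k M) (fun b : Tor (fine (L ^ k) M) × Fin (d + 1) => blockOf (L ^ k) M b.1))
      (BlockNorm.ofBlocks (unitTorusGeo L k M) (fun b' : Tor (fine (L ^ r * L ^ k) M) × Fin (d + 1) => blockOf (L ^ r * L ^ k) M b'.1))
      (idef (pull (kingPrV L k r M)) (pull (kingPrV L k r M))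
        (bshiftV M (L ^ r * L ^ k) ν ∘ₗ (symbOp M (L ^ r * L ^ k) (sD M (L ^ r * L ^ k) ν ((L ^ r * L ^ k : ℕ) : ℝ)) ∘ₗ gOp M (L ^ r * L ^ k) a))
        (bshiftV M (L ^ k) ν ∘ₗ (symbOp M (L ^ k) (sD M (L ^ k) ν ((L ^ k : ℕ) : ℝ)) ∘ₗ gOp M (L ^ k) a)))
      (fun y y' => C₀' * Real.exp (-(δ * tdistT M y y'))))
    (h3a : ∀ μ : Fin (d + 1), HasMaj (BlockNorm.ofBlocks (unitTorusGeo L k M) (fun b : Tor (fine (L ^ k) M) × Fin (d + 1) => blockOf (L ^ k) M b.1))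
      (BlockNorm.ofBlocks (unitTorusGeo L k M) (fun b : Tor (fine (L ^ k) M) × Fin (d + 1) => blockOf (L ^ k) M b.1))
      (symbOp M (L ^ k) (sD M (L ^ k) μ ((L ^ k : ℕ) : ℝ)) ∘ₗ symbOp M (L ^ k) (sD M (L ^ k) ν ((L ^ k : ℕ) : ℝ)) ∘ₗ gOp M (L ^ k) a)
      (fun y y' => C₃ * Real.exp (-(δ * tdistT M y y'))))
    (h3b : ∀ μ : Fin (d + 1), HasMaj (BlockNorm.ofBlocks (unitTorusGeo L k M) (fun b : Tor (fine (L ^ k) M) × Fin (d + 1) => blockOf (L ^ k) M b.1))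
      (BlockNorm.ofBlocks (unitTorusGeo L k M) (fun b : Tor (fine (L ^ k) M) × Fin (d + 1) => blockOf (L ^ k) M b.1))
      (bshiftV M (L ^ k) ν ∘ₗ (symbOp M (L ^ k) (sD M (L ^ k) μ ((L ^ k : ℕ) : ℝ)) ∘ₗ symbOp M (L ^ k) (sD M (L ^ k) ν ((L ^ k : ℕ) : ℝ)) ∘ₗ gOp M (L ^ k) a))
      (fun y y' => C₃' * Real.exp (-(δ * tdistT M y y')))) :
    HasMaj (BlockNorm.ofBlocks (unitTorusGeo L k M) (fun b : Tor (fine (L ^ k) M) × Fin (d + 1) => blockOf (L ^ k) M b.1))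
      (BlockNorm.ofBlocks (unitTorusGeo L k M) (fun b' : Tor (fine (L ^ r * L ^ k) M) × Fin (d + 1) => blockOf (L ^ r * L ^ k) M b'.1))
      (idef (pull (kingPrV L k r M)) (pull (kingPrV L k r M))
        (mulOp (chiCube M (L ^ r * L ^ k) c S) ∘ₗ symbOp M (L ^ r * L ^ k) (((L ^ r * L ^ k : ℕ) : ℝ) • (sTinv M (L ^ r * L ^ k) ν - 1)) ∘ₗ neumannCubeG M (L ^ r * L ^ k) c S a)
        (mulOp (chiCube M (L ^ k) c S) ∘ₗ symbOp M (L ^ k) (((L ^ k : ℕ) : ℝ) • (sTinv M (L ^ k) ν - 1)) ∘ₗ neumannCubeG M (L ^ k) c S a))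
      (fun y y' => ind (cubeBlocks M c S : Set (Tor M)) y * ind (cubeBlocks M c S : Set (Tor M)) y' *
        (2 ^ d * Real.exp δ * ((C₀ + C₀') + (d + 1) * ((C₃ + C₃') / (L ^ k : ℕ))) * Real.exp (-(δ * tdistT M y y')))) := by
  rw [idef_chiCube_divAdjOut_neumannCubeG_split L k r c S a hM ha ν]
  have hK0 : ∀ y y' : Tor M, 0 ≤ C₀ * Real.exp (-(δ * tdistT M y y')) := fun _ _ => mul_nonneg hC₀ (Real.exp_nonneg _)
  have hK0' : ∀ y y' : Tor M, 0 ≤ C₀' * Real.exp (-(δ * tdistT M y y')) := fun _ _ => mul_nonneg hC₀' (Real.exp_nonneg _)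
  have hC3 : (0 : ℝ) ≤ (d + 1) * (C₃ / (L ^ k : ℕ)) := by positivity
  have hC3' : (0 : ℝ) ≤ (d + 1) * (C₃' / (L ^ k : ℕ)) := by positivity
  have hK3 : ∀ y y' : Tor M, 0 ≤ (d + 1) * (C₃ / (L ^ k : ℕ)) * Real.exp (-(δ * tdistT M y y')) := fun _ _ => mul_nonneg hC3 (Real.exp_nonneg _)
  have hK3' : ∀ y y' : Tor M, 0 ≤ (d + 1) * (C₃' / (L ^ k : ℕ)) * Real.exp (-(δ * tdistT M y y')) := fun _ _ => mul_nonneg hC3' (Real.exp_nonneg _)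
  -- the images-dressed torus defects
  have hA := fun T : Finset (Fin (d + 1)) => hasMaj_chiCube_reflSet_comp hC₀ hδ hM T (hasMaj_comp_mulOp_chiCube (c := c) (S := S) hK0 h0a)
  have hA' := fun T : Finset (Fin (d + 1)) => hasMaj_chiCube_reflSet_comp hC₀' hδ hM T (hasMaj_comp_mulOp_chiCube (c := c) (S := S) hK0' h0b)
  -- the face terms: second differences, source-localized, reflected, paired, masked
  have hDa := hasMaj_ownDiff_comp (T := symbOp M (L ^ k) (sD M (L ^ k) ν ((L ^ k : ℕ) : ℝ)) ∘ₗ gOp M (L ^ k) a) hC₃ h3a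
  have hXa : HasMaj (BlockNorm.ofBlocks (unitTorusGeo L k M) (fun b : Tor (fine (L ^ k) M) × Fin (d + 1) => blockOf (L ^ k) M b.1))
      (BlockNorm.ofBlocks (unitTorusGeo L k M) (fun b : Tor (fine (L ^ k) M) × Fin (d + 1) => blockOf (L ^ k) M b.1))
      ((ownDiff M (L ^ k) ∘ₗ symbOp M (L ^ k) (sD M (L ^ k) ν ((L ^ k : ℕ) : ℝ))) ∘ₗ gOp M (L ^ k) a ∘ₗ mulOp (chiCube M (L ^ k) c S))
      (fun y y' => ind (cubeBlocks M c S : Set (Tor M)) y' * ((d + 1) * (C₃ / (L ^ k : ℕ)) * Real.exp (-(δ * tdistT M y y')))) :=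
    (hasMaj_comp_mulOp_chiCube (c := c) (S := S) hK3 hDa).congr fun μ => rfl
  have hB := fun T : Finset (Fin (d + 1)) => hasMaj_faceTerm (r := r) (c := c) hM hC3 hδ T hXa
  have h3b' : ∀ μ : Fin (d + 1), HasMaj (BlockNorm.ofBlocks (unitTorusGeo L k M) (fun b : Tor (fine (L ^ k) M) × Fin (d + 1) => blockOf (L ^ k) M b.1))
      (BlockNorm.ofBlocks (unitTorusGeo L k M) (fun b : Tor (fine (L ^ k) M) × Fin (d + 1) => blockOf (L ^ k) M b.1))
      (symbOp M (L ^ k) (sD M (L ^ k) μ ((L ^ k : ℕ) : ℝ)) ∘ₗ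
        (bshiftV M (L ^ k) ν ∘ₗ (symbOp M (L ^ k) (sD M (L ^ k) ν ((L ^ k : ℕ) : ℝ)) ∘ₗ gOp M (L ^ k) a)))
      (fun y y' => C₃' * Real.exp (-(δ * tdistT M y y'))) := fun μ =>
    (h3b μ).congr fun f => LinearMap.congr_fun
      (symbOp_sD_comp_bshiftV_comp μ ν ((L ^ k : ℕ) : ℝ) (symbOp M (L ^ k) (sD M (L ^ k) ν ((L ^ k : ℕ) : ℝ)) ∘ₗ gOp M (L ^ k) a)).symm f
  have hDb := hasMaj_ownDiff_comp (T := bshiftV M (L ^ k) ν ∘ₗ (symbOp M (L ^ k) (sD M (L ^ k) ν ((L ^ k : ℕ) : ℝ)) ∘ₗ gOp M (L ^ k) a)) hC₃' h3b'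
  have hXb : HasMaj (BlockNorm.ofBlocks (unitTorusGeo L k M) (fun b : Tor (fine (L ^ k) M) × Fin (d + 1) => blockOf (L ^ k) M b.1))
      (BlockNorm.ofBlocks (unitTorusGeo L k M) (fun b : Tor (fine (L ^ k) M) × Fin (d + 1) => blockOf (L ^ k) M b.1))
      ((ownDiff M (L ^ k) ∘ₗ bshiftV M (L ^ k) ν ∘ₗ symbOp M (L ^ k) (sD M (L ^ k) ν ((L ^ k : ℕ) : ℝ))) ∘ₗ gOp M (L ^ k) a ∘ₗ mulOp (chiCube M (L ^ k) c S))
      (fun y y' => ind (cubeBlocks M c S : Set (Tor M)) y' * ((d + 1) * (C₃' / (L ^ k : ℕ)) * Real.exp (-(δ * tdistT M y y')))) :=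
    (hasMaj_comp_mulOp_chiCube (c := c) (S := S) hK3' hDb).congr fun μ => rfl
  have hB' := fun T : Finset (Fin (d + 1)) => hasMaj_faceTerm (r := r) (c := c) hM hC3' hδ T hXb
  refine (hasMaj_finsum ((Finset.univ : Finset (Fin (d + 1))).erase ν).powerset _ _ fun T _ =>
    ((hA' T).add (hB' T)).neg.add ((hA (insert ν T)).add (hB (insert ν T)))).mono fun y y' => le_of_eq ?_
  rw [Finset.sum_const, Finset.card_powerset, Finset.card_erase_of_mem (Finset.mem_univ ν), Finset.card_univ, Fintype.card_fin, Nat.add_sub_cancel,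
    nsmul_eq_mul]
  push_cast
  ring

/-- ★★★ **THE η-DEFECT LETTER OF THE ADJOINT-DIFFERENCE OUTPUT ROW OF THE NEUMANN CUBES AT `U ≡ 1`, HYPOTHESIS-FREE** on the torus family (`L^k ≥ 4`): `∃ δ m > 0`,
`𝔇(χ′_□∇′*_νG′(□), χ_□∇*_νG(□)) ≤ 1_□(y)1_□(y′)·m·(L^k)^{−1∕16}·e^{−δ|y−y′|_T}` — the same two torus defects as N-IIe (part 53, dag-n15-c W1) with the roles of the image
classes swapped, faces by `hasMaj_gradStep_of_ineq` at `α = ½`.  The defect of dag-n15-c's `hDbc` rows (`bgrad = −∇*`; `idef_neg_neg`∕`HasMaj.neg` for the sign).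
[cite: Balaban1985BackgroundPropagators, Thm 3.14 pp.426–427, (3.42) p.397 (shape); King1986, Prop. 3.9 (3.73) p.665 (A = 0 model); Balaban1984PropagatorsII, (2.134) p.247, (2.37) p.229] -/
theorem hasMaj_idef_chiCube_divAdjOut_neumannCubeG (hLodd : Odd L) (hL2 : 2 ≤ L) {a : ℝ} (ha : 0 < a) :
    ∃ δ m : ℝ, 0 < δ ∧ 0 < m ∧ ∀ (mT k r : ℕ) (hk : 1 ≤ k) (hn4 : 4 ≤ L ^ k) (hL : Odd L ∧ 1 < L) (c : Tor (MP (paramsOf d L mT k hL))) (ν : Fin (d + 1)),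
      HasMaj (BlockNorm.ofBlocks (unitTorusGeo L k (MP (paramsOf d L mT k hL))) (blkFine L k (MP (paramsOf d L mT k hL))))
        (BlockNorm.ofBlocks (unitTorusGeo L k (MP (paramsOf d L mT k hL)))
          (fun i : Tor (fine (L ^ r * L ^ k) (MP (paramsOf d L mT k hL))) × Fin (d + 1) => blockOf (L ^ r * L ^ k) (MP (paramsOf d L mT k hL)) i.1))
        (idef (pull (kingPrV L k r (MP (paramsOf d L mT k hL)))) (pull (kingPrV L k r (MP (paramsOf d L mT k hL))))
          (mulOp (chiCube (MP (paramsOf d L mT k hL)) (L ^ r * L ^ k) c (L ^ mT)) ∘ₗ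
            symbOp (MP (paramsOf d L mT k hL)) (L ^ r * L ^ k) (((L ^ r * L ^ k : ℕ) : ℝ) • (sTinv (MP (paramsOf d L mT k hL)) (L ^ r * L ^ k) ν - 1)) ∘ₗ
              neumannCubeG (MP (paramsOf d L mT k hL)) (L ^ r * L ^ k) c (L ^ mT) a)
          (mulOp (chiCube (MP (paramsOf d L mT k hL)) (L ^ k) c (L ^ mT)) ∘ₗ
            symbOp (MP (paramsOf d L mT k hL)) (L ^ k) (((L ^ k : ℕ) : ℝ) • (sTinv (MP (paramsOf d L mT k hL)) (L ^ k) ν - 1)) ∘ₗ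
              neumannCubeG (MP (paramsOf d L mT k hL)) (L ^ k) c (L ^ mT) a))
        (fun y y' => ind ((cubeBlocks (MP (paramsOf d L mT k hL)) c (L ^ mT) : Finset _) : Set _) y *
          ind ((cubeBlocks (MP (paramsOf d L mT k hL)) c (L ^ mT) : Finset _) : Set _) y' *
          (m * ((L ^ k : ℕ) : ℝ) ^ (-(1 / 16 : ℝ)) * Real.exp (-(δ * tdistT (MP (paramsOf d L mT k hL)) y y')))) := by
  have hL : Odd L ∧ 1 < L := ⟨hLodd, by omega⟩
  obtain ⟨δ₁, C₁, hδ₁, hC₁, H1⟩ := hasMaj_twoGridDefect_grad (d := d) hLodd hL2 ha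
  obtain ⟨δ₂, C₂, hδ₂, hC₂, H2⟩ := GenuineSite.hasMaj_twoGridDefect_grad_backward (d := d) hLodd hL2 ha
  obtain ⟨δ₀, C, Cα, Cε, Cαε, hδ₀, hC, H3⟩ := ineq110_114_pair (d := d) hL ha
  have hLθ0 : 0 ≤ Lθ (d + 1) := Lθ_nonneg _
  obtain ⟨δ, hδdef⟩ : ∃ δ : ℝ, δ = min (min δ₁ δ₂) δ₀ := ⟨_, rfl⟩
  have hδpos : 0 < δ := hδdef ▸ lt_min (lt_min hδ₁ hδ₂) hδ₀
  have hδ₁le : δ ≤ δ₁ := hδdef ▸ (min_le_left _ _).trans (min_le_left _ _)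
  have hδ₂le : δ ≤ δ₂ := hδdef ▸ (min_le_left _ _).trans (min_le_right _ _)
  have hδ₀le : δ ≤ δ₀ := hδdef ▸ min_le_right _ _
  obtain ⟨CH, hCH⟩ : ∃ CH : ℝ, CH = |Cα (1 / 2)| * (Lθ (d + 1) + 1) * Real.exp δ₀ * Real.exp δ₀ * 2 := ⟨_, rfl⟩
  have hCH0 : 0 ≤ CH := by rw [hCH]; positivity
  have he1 : 1 ≤ Real.exp δ₀ := Real.one_le_exp hδ₀.le
  refine ⟨δ, 2 ^ (d + 1) * Real.exp δ * ((C₁ + C₂) + (d + 1) * CH), hδpos, by positivity, fun mT k r hk hn4 hL' c ν => ?_⟩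
  have hM : ∀ μ, MP (paramsOf d L mT k hL') μ = 2 * L ^ mT := fun μ => rfl
  have hM2 : ∀ μ, 2 ≤ MP (paramsOf d L mT k hL') μ := fun μ => by
    rw [hM μ]; exact Nat.le_mul_of_pos_right 2 (pow_pos (by omega) _)
  have hn1 : 1 ≤ L ^ k := Nat.one_le_pow _ _ (by omega)
  have hnr1 : (1 : ℝ) ≤ ((L ^ k : ℕ) : ℝ) := by exact_mod_cast hn1
  have hnr0 : (0 : ℝ) < ((L ^ k : ℕ) : ℝ) := by linarith
  have hρ0 : 0 ≤ ((L ^ k : ℕ) : ℝ) ^ (-(1 / 16 : ℝ)) := Real.rpow_nonneg hnr0.le _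
  -- the two torus defects at this index, decay weakened to `δ`
  have h0a := hasMaj_rate_mono (A := C₁ * ((L ^ k : ℕ) : ℝ) ^ (-(1 / 16 : ℝ))) (mul_nonneg hC₁.le hρ0) hδ₁le (H1 mT k r hk hL' ν)
  have h0b := hasMaj_rate_mono (A := C₂ * ((L ^ k : ℕ) : ℝ) ^ (-(1 / 16 : ℝ))) (mul_nonneg hC₂.le hρ0) hδ₂le (H2 mT k r hk hL' ν)
  -- the second differences: Hölder letter at `α = ½`, plain and shifted back
  have hS := fun μ => hasMaj_gradStep_of_ineq (L := L) (k := k) (MP (paramsOf d L mT k hL')) (L ^ k) a hn4 hM2 (H3 mT k r hk).1 hδ₀.le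
    (α := 1 / 2) (by norm_num) (by norm_num) μ ν
  have hB0 : 0 ≤ |Cα (1 / 2)| * (Lθ (d + 1) + 1) * Real.exp δ₀ * ((L ^ k : ℕ) : ℝ) ^ (1 - 1 / 2 : ℝ) :=
    mul_nonneg (by positivity) (Real.rpow_nonneg hnr0.le _)
  have h3a := fun μ => hasMaj_rate_mono hB0 hδ₀le (hS μ)
  have h3b := fun μ => hasMaj_rate_mono (mul_nonneg hB0 (Real.exp_nonneg δ₀)) hδ₀le (hasMaj_bshiftV_comp (MP (paramsOf d L mT k hL')) k (L ^ k) hB0 hδ₀.le ν (hS μ))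
  have hmain := hasMaj_idef_chiCube_divAdjOut_neumannCubeG_of (r := r) (c := c) hM ha ν (mul_nonneg hC₁.le hρ0) (mul_nonneg hC₂.le hρ0) hB0
    (mul_nonneg hB0 (Real.exp_nonneg δ₀)) hδpos.le h0a h0b h3a h3b
  refine hmain.mono fun y y' => ?_
  -- `(L^k)^{1−½}∕L^k = (L^k)^{−½} ≤ (L^k)^{−1∕16}`
  have hpow : ((L ^ k : ℕ) : ℝ) ^ (1 - 1 / 2 : ℝ) / ((L ^ k : ℕ) : ℝ) ≤ ((L ^ k : ℕ) : ℝ) ^ (-(1 / 16 : ℝ)) := by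
    rw [div_eq_mul_inv, ← Real.rpow_neg_one, ← Real.rpow_add hnr0]
    exact Real.rpow_le_rpow_of_exponent_le hnr1 (by norm_num)
  have hB1 : 0 ≤ |Cα (1 / 2)| * (Lθ (d + 1) + 1) * Real.exp δ₀ := by positivity
  have h2d : (0 : ℝ) ≤ 2 ^ d * Real.exp δ := by positivity
  have hd1 : (0 : ℝ) ≤ (d : ℝ) + 1 := by positivity
  have hsum : (|Cα (1 / 2)| * (Lθ (d + 1) + 1) * Real.exp δ₀ * ((L ^ k : ℕ) : ℝ) ^ (1 - 1 / 2 : ℝ) +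
      |Cα (1 / 2)| * (Lθ (d + 1) + 1) * Real.exp δ₀ * ((L ^ k : ℕ) : ℝ) ^ (1 - 1 / 2 : ℝ) * Real.exp δ₀) / ((L ^ k : ℕ) : ℝ) ≤ CH * ((L ^ k : ℕ) : ℝ) ^ (-(1 / 16 : ℝ)) := by
    rw [hCH, show (|Cα (1 / 2)| * (Lθ (d + 1) + 1) * Real.exp δ₀ * ((L ^ k : ℕ) : ℝ) ^ (1 - 1 / 2 : ℝ) +
      |Cα (1 / 2)| * (Lθ (d + 1) + 1) * Real.exp δ₀ * ((L ^ k : ℕ) : ℝ) ^ (1 - 1 / 2 : ℝ) * Real.exp δ₀) / ((L ^ k : ℕ) : ℝ) =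
      |Cα (1 / 2)| * (Lθ (d + 1) + 1) * Real.exp δ₀ * (1 + Real.exp δ₀) * (((L ^ k : ℕ) : ℝ) ^ (1 - 1 / 2 : ℝ) / ((L ^ k : ℕ) : ℝ)) by ring]
    have h1e : |Cα (1 / 2)| * (Lθ (d + 1) + 1) * Real.exp δ₀ * (1 + Real.exp δ₀) ≤ |Cα (1 / 2)| * (Lθ (d + 1) + 1) * Real.exp δ₀ * (Real.exp δ₀ + Real.exp δ₀) :=
      mul_le_mul_of_nonneg_left (add_le_add_left he1 _) hB1
    calc |Cα (1 / 2)| * (Lθ (d + 1) + 1) * Real.exp δ₀ * (1 + Real.exp δ₀) * (((L ^ k : ℕ) : ℝ) ^ (1 - 1 / 2 : ℝ) / ((L ^ k : ℕ) : ℝ))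
        ≤ |Cα (1 / 2)| * (Lθ (d + 1) + 1) * Real.exp δ₀ * (Real.exp δ₀ + Real.exp δ₀) * ((L ^ k : ℕ) : ℝ) ^ (-(1 / 16 : ℝ)) :=
          mul_le_mul h1e hpow (div_nonneg (Real.rpow_nonneg hnr0.le _) hnr0.le) (mul_nonneg hB1 (by positivity))
      _ = |Cα (1 / 2)| * (Lθ (d + 1) + 1) * Real.exp δ₀ * Real.exp δ₀ * 2 * ((L ^ k : ℕ) : ℝ) ^ (-(1 / 16 : ℝ)) := by ring
  have hcoef : 2 ^ d * Real.exp δ * ((C₁ * ((L ^ k : ℕ) : ℝ) ^ (-(1 / 16 : ℝ)) + C₂ * ((L ^ k : ℕ) : ℝ) ^ (-(1 / 16 : ℝ))) + (d + 1) *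
        ((|Cα (1 / 2)| * (Lθ (d + 1) + 1) * Real.exp δ₀ * ((L ^ k : ℕ) : ℝ) ^ (1 - 1 / 2 : ℝ) +
          |Cα (1 / 2)| * (Lθ (d + 1) + 1) * Real.exp δ₀ * ((L ^ k : ℕ) : ℝ) ^ (1 - 1 / 2 : ℝ) * Real.exp δ₀) / ((L ^ k : ℕ) : ℝ))) ≤
      2 ^ (d + 1) * Real.exp δ * ((C₁ + C₂) + (d + 1) * CH) * ((L ^ k : ℕ) : ℝ) ^ (-(1 / 16 : ℝ)) :=
    calc 2 ^ d * Real.exp δ * ((C₁ * ((L ^ k : ℕ) : ℝ) ^ (-(1 / 16 : ℝ)) + C₂ * ((L ^ k : ℕ) : ℝ) ^ (-(1 / 16 : ℝ))) + (d + 1) *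
          ((|Cα (1 / 2)| * (Lθ (d + 1) + 1) * Real.exp δ₀ * ((L ^ k : ℕ) : ℝ) ^ (1 - 1 / 2 : ℝ) +
            |Cα (1 / 2)| * (Lθ (d + 1) + 1) * Real.exp δ₀ * ((L ^ k : ℕ) : ℝ) ^ (1 - 1 / 2 : ℝ) * Real.exp δ₀) / ((L ^ k : ℕ) : ℝ)))
        ≤ 2 ^ d * Real.exp δ * ((C₁ * ((L ^ k : ℕ) : ℝ) ^ (-(1 / 16 : ℝ)) + C₂ * ((L ^ k : ℕ) : ℝ) ^ (-(1 / 16 : ℝ))) + (d + 1) * (CH * ((L ^ k : ℕ) : ℝ) ^ (-(1 / 16 : ℝ)))) :=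
          mul_le_mul_of_nonneg_left (add_le_add_right (mul_le_mul_of_nonneg_left hsum hd1) _) h2d
      _ = 2 ^ d * Real.exp δ * ((C₁ + C₂) + (d + 1) * CH) * ((L ^ k : ℕ) : ℝ) ^ (-(1 / 16 : ℝ)) := by ring
      _ ≤ 2 ^ (d + 1) * Real.exp δ * ((C₁ + C₂) + (d + 1) * CH) * ((L ^ k : ℕ) : ℝ) ^ (-(1 / 16 : ℝ)) := by
          have : (2 : ℝ) ^ d ≤ 2 ^ (d + 1) := by rw [pow_succ]; linarith [pow_pos (by norm_num : (0 : ℝ) < 2) d]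
          have hin : 0 ≤ Real.exp δ * ((C₁ + C₂) + (d + 1) * CH) * ((L ^ k : ℕ) : ℝ) ^ (-(1 / 16 : ℝ)) := by positivity
          nlinarith [this, hin]
  exact mul_le_mul_of_nonneg_left (mul_le_mul_of_nonneg_right hcoef (Real.exp_nonneg _)) (mul_nonneg (ind_nonneg _ _) (ind_nonneg _ _))

end DivAdjOutLetter

end Summit.QuantumFields.YangMills.BalabanUVNodes.N15.TwoGrid
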